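import Summits.AtomisticToContinuum.BoseEinsteinCondensation.Theses.BECStronglyRayleigh
import Summits.AtomisticToContinuum.BoseEinsteinCondensation.Theorems.InsertionFieldDelocalisation.Negative.Toolkit
import Summits.AtomisticToContinuum.BoseEinsteinCondensation.Theorems.InsertionFieldDelocalisation.Negative.PerronExistence
import Summits.AtomisticToContinuum.BoseEinsteinCondensation.Theorems.InsertionFieldDelocalisation.Negative.Tightness
import Summits.AtomisticToContinuum.BoseEinsteinCondensation.Theorems.BECStronglyRayleighGroundStateStabilityEulerGate
import Literature.MathematicalPhysics.QuantumLattice.LiebMattisSectorPF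
import Literature.MathematicalPhysics.QuantumLattice.FinDimSpectrumSectorGibbsLimit
import Literature.MathematicalPhysics.QuantumLattice.XYOrderDischarges
import HarnessLib

/-!
# Row-sum bounds for hard-core bosons on `(ℤ/Lℤ)³`: helper for stub `stub_excessBound` (STUB 2) of
# line `mobile-trap-dirichlet-eigenfunction`, crux `BECStronglyRayleigh.InsertionFieldDelocalisation`
# (stmt-AtomisticToContinuum-9673)

Supports (does not close) stmt-AtomisticToContinuum-9673. Hard-core bosons on the torus `(ℤ/Lℤ)³`
are the ferromagnetic spin-½ XY model `xyTorus 3 L 1 = xxzHamiltonian 1 (torusGraph 3 L) (-1) 0`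
(occupied = index `0`; hopping amplitude `-½` per allowed nearest-neighbour move, zero diagonal).

* `mt2ex_bond_form` : one bond as a quadratic form in the occupation basis,
  `⟨φ, (SˣSˣ + SʸSʸ)_{xy} φ⟩ = ½ Σ_σ [σ_x ≠ σ_y] conj φ(σ) φ(σ ∘ (x y))` (`gate_xxzBond_mulVec_apply`),
  and `mt2ex_re_bond_form_le` : `Re ⟨φ, (SˣSˣ + SʸSʸ)_{xy} φ⟩ ≤ ½ Σ_σ [σ_x ≠ σ_y] |φ(σ)|²` (AM–GM);
* `mt2ex_cL_mul_re_form` : `c_L · Re ⟨φ, Hφ⟩ = -Σ_x Σ_i Re ⟨φ, (SˣSˣ + SʸSʸ)_{x, x+eᵢ} φ⟩` over the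
  `3L³` site–direction pairs (`sum_pairs_eq_sum_edgeFinset`; `c_L = 2` iff `L = 2`, else `1`);
* `mt2ex_re_form_ge` : the row-sum (Gershgorin) bound `Re ⟨φ, Hφ⟩ ≥ -3 Σ_σ #{z | σ_z = 0} |φ(σ)|²`
  (a particle has at most `6` moves), and `mt2ex_E_lower` : `E(N) ≥ -3N` for the sector ground
  energy `E(N) = lowestEnergyInSector 1 (xyTorus 3 L 1) (N - L³/2)` of `N ≤ L³` bosons;
* `mt2ex_re_star_dotProduct_self`, `mt2ex_card_occ_comp_equiv` : small bookkeeping facts;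
* `stub_excessBoundRowSum` : the registered sub-goal `∀ L ≥ 2, ∀ N ≤ L³, -3N ≤ E(N)` (= `mt2ex_E_lower`).

All statements are finite-dimensional linear algebra and counting. [folklore]
-/

noncomputable section

namespace Summit.AtomisticToContinuum.BoseEinsteinCondensation.Cruxes.InsertionFieldDelocalisation.MobileTrapDirichletEigenfunction

open scoped BigOperators ComplexOrder
open Literature.MathematicalPhysics.QuantumLattice Literature.Probability.LatticeModels Matrix Finset
open Summit.AtomisticToContinuum.BoseEinsteinCondensation.Theorems.InsertionFieldDelocalisation.Negative
open Summit.AtomisticToContinuum.BoseEinsteinCondensation.Cruxes.GroundStateStability.StableConeVariationalSelection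
  (gate_xxzBond_mulVec_apply)

/-! ### One bond in the occupation basis -/

section General

variable {Λ : Type*} [Fintype Λ] [DecidableEq Λ]

omit [Fintype Λ] in
/-- Swapping the values of a configuration at two sites is precomposition with the transposition.
[folklore] -/
theorem mt2ex_update_update_eq_comp_swap (x y : Λ) (σ : TensorIndex Λ 2) :
    Function.update (Function.update σ x (σ y)) y (σ x) = σ ∘ Equiv.swap x y := by
  funext z
  by_cases hzy : z = y
  · subst hzy
    rw [Function.update_self, Function.comp_apply, Equiv.swap_apply_right]
  · rw [Function.update_of_ne hzy]
    by_cases hzx : z = x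
    · subst hzx
      rw [Function.update_self, Function.comp_apply, Equiv.swap_apply_left]
    · rw [Function.update_of_ne hzx, Function.comp_apply, Equiv.swap_apply_of_ne_of_ne hzx hzy]

/-- **The XY bond as a quadratic form in the occupation basis**:
`⟨φ, (SˣSˣ + SʸSʸ)_{xy} φ⟩ = ½ Σ_σ [σ_x ≠ σ_y] conj φ(σ) φ(σ ∘ (x y))`. [folklore] -/
theorem mt2ex_bond_form {x y : Λ} (hxy : x ≠ y) (φ : TensorIndex Λ 2 → ℂ) :
    star φ ⬝ᵥ (spinBond 1 0 x y + spinBond 1 1 x y + ((0 : ℝ) : ℂ) • spinBond 1 2 x y) *ᵥ φ =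
      ∑ σ, if σ x = σ y then 0 else (1 / 2 : ℂ) * (star (φ σ) * φ (σ ∘ Equiv.swap x y)) := by
  rw [dotProduct]
  refine Finset.sum_congr rfl fun σ _ => ?_
  rw [Pi.star_apply, gate_xxzBond_mulVec_apply hxy, mt2ex_update_update_eq_comp_swap,
    Complex.ofReal_zero, zero_mul, zero_mul, zero_add]
  split_ifs
  · rw [mul_zero]
  · ring

omit [Fintype Λ] in
/-- Precomposition with the transposition `(x y)` is an involution of the configurations. [folklore] -/
theorem mt2ex_comp_swap_involutive (x y : Λ) :
    Function.Involutive (fun σ : TensorIndex Λ 2 => σ ∘ Equiv.swap x y) := fun σ => by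
  funext z
  simp only [Function.comp_apply, Equiv.swap_apply_self]

/-- **Row-sum bound for one bond**: `Re ⟨φ, (SˣSˣ + SʸSʸ)_{xy} φ⟩ ≤ ½ Σ_σ [σ_x ≠ σ_y] |φ(σ)|²`
(AM–GM and the symmetry `σ ↦ σ ∘ (x y)`). [folklore] -/
theorem mt2ex_re_bond_form_le {x y : Λ} (hxy : x ≠ y) (φ : TensorIndex Λ 2 → ℂ) :
    (star φ ⬝ᵥ (spinBond 1 0 x y + spinBond 1 1 x y + ((0 : ℝ) : ℂ) • spinBond 1 2 x y) *ᵥ φ).re ≤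
      (1 / 2) * ∑ σ, if σ x = σ y then (0 : ℝ) else ‖φ σ‖ ^ 2 := by
  rw [mt2ex_bond_form hxy, Complex.re_sum]
  have hterm : ∀ σ : TensorIndex Λ 2,
      (if σ x = σ y then (0 : ℂ) else (1 / 2 : ℂ) * (star (φ σ) * φ (σ ∘ Equiv.swap x y))).re ≤
        (1 / 4) * (if σ x = σ y then (0 : ℝ) else ‖φ σ‖ ^ 2) +
          (1 / 4) * (if (σ ∘ Equiv.swap x y) x = (σ ∘ Equiv.swap x y) y then (0 : ℝ)
            else ‖φ (σ ∘ Equiv.swap x y)‖ ^ 2) := by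
    intro σ
    have hsw : ((σ ∘ Equiv.swap x y) x = (σ ∘ Equiv.swap x y) y) ↔ (σ x = σ y) := by
      simp only [Function.comp_apply, Equiv.swap_apply_left, Equiv.swap_apply_right]
      exact eq_comm
    rw [if_congr hsw rfl rfl]
    split_ifs
    · simp
    · have h1 : ((1 / 2 : ℂ) * (star (φ σ) * φ (σ ∘ Equiv.swap x y))).re ≤
          (1 / 2) * (‖φ σ‖ * ‖φ (σ ∘ Equiv.swap x y)‖) := by
        refine (Complex.re_le_norm _).trans ?_
        rw [norm_mul, norm_mul, norm_star]
        norm_num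
      nlinarith [two_mul_le_add_sq ‖φ σ‖ ‖φ (σ ∘ Equiv.swap x y)‖]
  refine (Finset.sum_le_sum fun σ _ => hterm σ).trans ?_
  rw [Finset.sum_add_distrib, ← Finset.mul_sum, ← Finset.mul_sum]
  have hre : ∑ σ : TensorIndex Λ 2,
      (if (σ ∘ Equiv.swap x y) x = (σ ∘ Equiv.swap x y) y then (0 : ℝ)
        else ‖φ (σ ∘ Equiv.swap x y)‖ ^ 2) =
      ∑ σ : TensorIndex Λ 2, if σ x = σ y then (0 : ℝ) else ‖φ σ‖ ^ 2 :=
    Fintype.sum_equiv ((mt2ex_comp_swap_involutive x y).toPerm _) _ _ fun σ => rfl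
  rw [hre]
  linarith

omit [DecidableEq Λ] in
/-- The number of occupied sites is invariant under relabelling the sites. [folklore] -/
theorem mt2ex_card_occ_comp_equiv (σ : TensorIndex Λ 2) (e : Λ ≃ Λ) :
    (Finset.univ.filter fun z => (σ ∘ e) z = 0).card = (Finset.univ.filter fun z => σ z = 0).card :=
  Finset.card_equiv e fun z => by simp

omit [Fintype Λ] [DecidableEq Λ] in
/-- `Re ⟨v, v⟩ = Σ_i |v_i|²`. [folklore] -/
theorem mt2ex_re_star_dotProduct_self {ι : Type*} [Fintype ι] (v : ι → ℂ) :
    (star v ⬝ᵥ v).re = ∑ i, ‖v i‖ ^ 2 := by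
  rw [dotProduct, Complex.re_sum]
  refine Finset.sum_congr rfl fun i _ => ?_
  rw [Pi.star_apply, Complex.star_def, Complex.conj_mul', ← Complex.ofReal_pow, Complex.ofReal_re]

end General

/-! ### The XY torus: the quadratic form over site–direction pairs, and the row-sum lower bound -/

section Torus

/-- **The quadratic form of `xyTorus 3 L 1` over site–direction pairs**: with `c_L = 2` for `L = 2`
and `c_L = 1` for `L ≥ 3` (every edge `{x, x ± eᵢ}` arises from `c_L` pairs `(x, i)`),
`c_L · Re ⟨φ, H φ⟩ = -Σ_x Σ_i Re ⟨φ, (SˣSˣ + SʸSʸ)_{x, x+eᵢ} φ⟩`. [folklore] -/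
theorem mt2ex_cL_mul_re_form (L : ℕ) [NeZero L] (hL : 2 ≤ L)
    (φ : TensorIndex (TorusSite 3 L) 2 → ℂ) :
    (if L = 2 then (2 : ℝ) else 1) * (star φ ⬝ᵥ (xyTorus 3 L 1) *ᵥ φ).re =
      -∑ x : TorusSite 3 L, ∑ i : Fin 3,
        (star φ ⬝ᵥ (spinBond 1 0 x (x + Pi.single i 1) + spinBond 1 1 x (x + Pi.single i 1) +
          ((0 : ℝ) : ℂ) • spinBond 1 2 x (x + Pi.single i 1)) *ᵥ φ).re := by
  have hH : xyTorus 3 L 1 = ((-1 : ℝ) : ℂ) • ∑ e ∈ (torusGraph 3 L).edgeFinset,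
      Sym2.lift ⟨fun x y => spinBond 1 0 x y + spinBond 1 1 x y + ((0 : ℝ) : ℂ) • spinBond 1 2 x y,
        fun x y => by simp only [spinBond_comm]⟩ e := rfl
  have key := sum_pairs_eq_sum_edgeFinset L hL (fun e => (star φ ⬝ᵥ (Sym2.lift
    ⟨fun x y => spinBond 1 0 x y + spinBond 1 1 x y + ((0 : ℝ) : ℂ) • spinBond 1 2 x y,
      fun x y => by simp only [spinBond_comm]⟩ e) *ᵥ φ).re)
  simp only [Sym2.lift_mk] at key
  rw [key, hH, Matrix.smul_mulVec, dotProduct_smul, Matrix.sum_mulVec, dotProduct_sum,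
    smul_eq_mul, Complex.re_ofReal_mul, Complex.re_sum]
  ring

/-- On the torus with `L ≥ 2`, `x + eᵢ ≠ x`. [folklore] -/
theorem mt2ex_ne_add_single (L : ℕ) (hL : 2 ≤ L) (x : TorusSite 3 L) (i : Fin 3) :
    x ≠ x + Pi.single i 1 := by
  haveI : Fact (1 < L) := ⟨hL⟩
  intro h
  have h1 := congrFun (left_eq_add.mp h) i
  rw [Pi.single_eq_same, Pi.zero_apply] at h1
  exact one_ne_zero h1

/-- **At most `6` broken bonds per particle**: for a configuration `σ` on `(ℤ/Lℤ)³`, the number of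
site–direction pairs `(x, i)` with `σ_x ≠ σ_{x+eᵢ}` is at most `6 · #{z | σ_z = 0}` (each such pair has
an occupied endpoint; translation invariance of the count). [folklore] -/
theorem mt2ex_pairs_indicator_le (L : ℕ) [NeZero L] (σ : TensorIndex (TorusSite 3 L) 2) :
    ∑ x : TorusSite 3 L, ∑ i : Fin 3, (if σ x = σ (x + Pi.single i 1) then (0 : ℝ) else 1) ≤
      6 * ((Finset.univ.filter fun z => σ z = 0).card : ℝ) := by
  have hle : ∀ (x : TorusSite 3 L) (i : Fin 3),
      (if σ x = σ (x + Pi.single i 1) then (0 : ℝ) else 1) ≤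
        (if σ x = 0 then (1 : ℝ) else 0) + (if σ (x + Pi.single i 1) = 0 then (1 : ℝ) else 0) := by
    intro x i
    have h2 : ∀ a : Fin 2, a = 0 ∨ a = 1 := by decide
    rcases h2 (σ x) with h | h <;> rcases h2 (σ (x + Pi.single i 1)) with h' | h' <;> simp [h, h']
  have hcount : ∀ i : Fin 3,
      ∑ x : TorusSite 3 L, (if σ (x + Pi.single i 1) = 0 then (1 : ℝ) else 0) =
        ∑ x : TorusSite 3 L, (if σ x = 0 then (1 : ℝ) else 0) := fun i =>
    Fintype.sum_equiv (Equiv.addRight (Pi.single i 1)) _ _ fun x => rfl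
  have hN : ∑ x : TorusSite 3 L, (if σ x = 0 then (1 : ℝ) else 0) =
      ((Finset.univ.filter fun z => σ z = 0).card : ℝ) := by
    rw [Finset.sum_boole]
  calc ∑ x : TorusSite 3 L, ∑ i : Fin 3, (if σ x = σ (x + Pi.single i 1) then (0 : ℝ) else 1)
      ≤ ∑ x : TorusSite 3 L, ∑ i : Fin 3,
          ((if σ x = 0 then (1 : ℝ) else 0) + (if σ (x + Pi.single i 1) = 0 then (1 : ℝ) else 0)) :=
        Finset.sum_le_sum fun x _ => Finset.sum_le_sum fun i _ => hle x i
    _ = ∑ i : Fin 3, (∑ x : TorusSite 3 L, (if σ x = 0 then (1 : ℝ) else 0) +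
          ∑ x : TorusSite 3 L, (if σ (x + Pi.single i 1) = 0 then (1 : ℝ) else 0)) := by
        rw [Finset.sum_comm]
        simp only [Finset.sum_add_distrib]
    _ = 6 * ((Finset.univ.filter fun z => σ z = 0).card : ℝ) := by
        simp only [hcount, hN, Finset.sum_const, Finset.card_univ, Fintype.card_fin, nsmul_eq_mul]
        push_cast
        ring

/-- **Row-sum (Gershgorin) lower bound for the XY torus**:
`Re ⟨φ, H φ⟩ ≥ -3 Σ_σ #{z | σ_z = 0} |φ(σ)|²` — each of the particles of `σ` has at most `6` allowed
hops, each with amplitude `-½`. [folklore] -/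
theorem mt2ex_re_form_ge (L : ℕ) [NeZero L] (hL : 2 ≤ L) (φ : TensorIndex (TorusSite 3 L) 2 → ℂ) :
    -(3 * ∑ σ, ((Finset.univ.filter fun z => σ z = 0).card : ℝ) * ‖φ σ‖ ^ 2) ≤
      (star φ ⬝ᵥ (xyTorus 3 L 1) *ᵥ φ).re := by
  set S : ℝ := ∑ σ, ((Finset.univ.filter fun z => σ z = 0).card : ℝ) * ‖φ σ‖ ^ 2 with hS
  have hS0 : 0 ≤ S := Finset.sum_nonneg fun σ _ => by positivity
  have key : -(3 * S) ≤ (if L = 2 then (2 : ℝ) else 1) * (star φ ⬝ᵥ (xyTorus 3 L 1) *ᵥ φ).re := by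
    rw [mt2ex_cL_mul_re_form L hL φ, neg_le_neg_iff]
    calc ∑ x : TorusSite 3 L, ∑ i : Fin 3,
          (star φ ⬝ᵥ (spinBond 1 0 x (x + Pi.single i 1) + spinBond 1 1 x (x + Pi.single i 1) +
            ((0 : ℝ) : ℂ) • spinBond 1 2 x (x + Pi.single i 1)) *ᵥ φ).re
        ≤ ∑ x : TorusSite 3 L, ∑ i : Fin 3, (1 / 2) *
            ∑ σ, (if σ x = σ (x + Pi.single i 1) then (0 : ℝ) else ‖φ σ‖ ^ 2) :=
          Finset.sum_le_sum fun x _ => Finset.sum_le_sum fun i _ =>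
            mt2ex_re_bond_form_le (mt2ex_ne_add_single L hL x i) φ
      _ = ∑ x : TorusSite 3 L, ∑ i : Fin 3, ∑ σ, (1 / 2) * (‖φ σ‖ ^ 2 *
            (if σ x = σ (x + Pi.single i 1) then (0 : ℝ) else 1)) := by
          refine Finset.sum_congr rfl fun x _ => Finset.sum_congr rfl fun i _ => ?_
          rw [Finset.mul_sum]
          refine Finset.sum_congr rfl fun σ _ => ?_
          split_ifs <;> simp
      _ = ∑ σ, ∑ x : TorusSite 3 L, ∑ i : Fin 3, (1 / 2) * (‖φ σ‖ ^ 2 *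
            (if σ x = σ (x + Pi.single i 1) then (0 : ℝ) else 1)) :=
          (Finset.sum_congr rfl fun x _ => Finset.sum_comm).trans Finset.sum_comm
      _ = ∑ σ, (1 / 2) * (‖φ σ‖ ^ 2 * ∑ x : TorusSite 3 L, ∑ i : Fin 3,
            (if σ x = σ (x + Pi.single i 1) then (0 : ℝ) else 1)) := by
          simp only [Finset.mul_sum]
      _ ≤ ∑ σ, (1 / 2) * (‖φ σ‖ ^ 2 * (6 * ((Finset.univ.filter fun z => σ z = 0).card : ℝ))) := by
          gcongr with σ _
          exact mt2ex_pairs_indicator_le L σ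
      _ = 3 * S := by
          rw [hS, Finset.mul_sum]
          exact Finset.sum_congr rfl fun σ _ => by ring
  split_ifs at key
  · by_cases hR : 0 ≤ (star φ ⬝ᵥ (xyTorus 3 L 1) *ᵥ φ).re <;> linarith
  · linarith

/-- **`E(N) ≥ -3N`**: the ground energy of `N` hard-core bosons on `(ℤ/Lℤ)³` is at least `-3N`
(row-sum bound at the sector ground vector). [folklore] -/
theorem mt2ex_E_lower (L : ℕ) [NeZero L] (hL : 2 ≤ L) (N : ℕ) (hN : N ≤ L ^ 3) :
    -(3 * (N : ℝ)) ≤ lowestEnergyInSector 1 (xyTorus 3 L 1) ((N : ℝ) - (L : ℝ) ^ 3 / 2) := by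
  obtain ⟨ψ, hne, -, hsec, heig⟩ := exists_nonneg_sectorGroundState_xyTorus 3 L N hN
  have hocc : ∀ σ, ψ σ ≠ 0 → (Finset.univ.filter fun z => σ z = 0).card = N := by
    intro σ hσ
    have hmag := (LiebMattis.mem_spinZSector_iff 1 _ ψ).mp hsec σ hσ
    rw [← ind_filter_eq σ, magnetisation_ind, card_torusSite] at hmag
    push_cast at hmag
    have h : ((Finset.univ.filter fun z => σ z = 0).card : ℂ) = (N : ℂ) := by
      linear_combination hmag
    exact_mod_cast h
  have hform := mt2ex_re_form_ge L hL ψ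
  rw [heig, dotProduct_smul, smul_eq_mul, Complex.re_ofReal_mul, mt2ex_re_star_dotProduct_self]
    at hform
  have hsum : ∑ σ, ((Finset.univ.filter fun z => σ z = 0).card : ℝ) * ‖ψ σ‖ ^ 2 =
      N * ∑ σ, ‖ψ σ‖ ^ 2 := by
    rw [Finset.mul_sum]
    refine Finset.sum_congr rfl fun σ _ => ?_
    by_cases hσ : ψ σ = 0
    · simp [hσ]
    · rw [hocc σ hσ]
  rw [hsum] at hform
  have hpos : 0 < ∑ σ, ‖ψ σ‖ ^ 2 := by
    obtain ⟨σ, hσ⟩ := Function.ne_iff.mp hne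
    have h1 : 0 < ‖ψ σ‖ ^ 2 := by positivity
    exact lt_of_lt_of_le h1 (Finset.single_le_sum (f := fun σ => ‖ψ σ‖ ^ 2)
      (fun _ _ => sq_nonneg _) (Finset.mem_univ σ))
  nlinarith

/-- **Registered sub-goal `stub_excessBoundRowSum`** (helper of `stub_excessBound`, line
`mobile-trap-dirichlet-eigenfunction`): `E(N) ≥ -3N` for the sector ground energy of `N ≤ L³` hard-core
bosons on `(ℤ/Lℤ)³`, `L ≥ 2` (row-sum bound `mt2ex_E_lower`). [folklore] -/
theorem stub_excessBoundRowSum :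
    ∀ (L : ℕ) [NeZero L], 2 ≤ L → ∀ N : ℕ, N ≤ L ^ 3 →
      -(3 * (N : ℝ)) ≤ lowestEnergyInSector 1 (xyTorus 3 L 1) ((N : ℝ) - (L : ℝ) ^ 3 / 2) :=
  fun L _ hL N hN => mt2ex_E_lower L hL N hN

end Torus

end Summit.AtomisticToContinuum.BoseEinsteinCondensation.Cruxes.InsertionFieldDelocalisation.MobileTrapDirichletEigenfunction

end
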